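import Summits.CriticalPhenomena.PercolationContinuityZ3.Theorems.PercNearOneGluingNoHeavyLowerTailSunflowerGraphMarkClass
import Summits.CriticalPhenomena.PercolationContinuityZ3.Theorems.PercNearOneGluingNoHeavyLowerTailSunflowerSpectatorTransferOrPetalTriple
import HarnessLib

/-!
# `NoHeavyLowerTail` (crux stmt-CriticalPhenomena-4575), abstract sunflower cubic: WINDOW KIT — fast finite data for structured window certificates
# (the diamond `M₃` as an enumeration, kernel tables by pattern matching, bridges to `Fin 5`, generic row and label lemmas)

Support file (seat `prim-ineq-gen-2` gen 26; `--supports stmt-CriticalPhenomena-4575`).  No `sorry`; nothing is asserted about the crux.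
Memo: run/shared/lean/prim/prim-ineq-gen-2/GRAPHMARK-LEAN-GEN26.md §3 (generator v2).  PURPOSE: the structured three-point window certificates for the
degree-3 types (up to 5 external points, 30 375 realisable label/placement cases) are checked by `decide` over STRUCTURED data; evaluating `s6H`/`kk`
on `Fin 5` literals in the kernel costs ≈ 0.2 s per case, on the enumeration `M3` with `match` tables ≈ 5 ms.  This file provides the enumeration
(`M3`, `M3.ofFin`), the tables (`s6HM`, `kkM`, `joinMM`, `thetaBM`) with the bridges `s6H_eq_s6HM`, `kk_eq_kkM`, `ofFin_joinM_theta` (all `decide`),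
the block-of-a-point function `blk` with `blk_decide_eq` (realisability ⇒ a placement of the externals), the generic spectator-weighted polarised
Gladkov row `Sunflower.nested_weight_mul_kk_union_nonneg` (nested offsets `G₂ ⊆ G₁`), the two- and three-point label calculus
`IsGraphMarkOn.lab_insert₂/₃` and `nb_eq_ite₂` (a point with two neighbours), and linearity of `nested`.
-/

namespace Summit.CriticalPhenomena.PercolationContinuityZ3.Theorems.SunflowerPartition

open Finset

/-! ## `M₃` as an enumeration and the kernel tables -/

/-- The diamond `M₃`: bottom, three petals, top. [this work] -/
inductive M3
  | b
  | c1
  | c2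
  | c3
  | t
  deriving DecidableEq, Fintype

/-- From the `Fin 5` coding (`0 ↦ ⊥`, `i ↦` petal `i`, `4 ↦ ⊤`). [this work] -/
def M3.ofFin (x : Fin 5) : M3 :=
  if x = 0 then M3.b else if x = 1 then M3.c1 else if x = 2 then M3.c2 else if x = 3 then M3.c3 else M3.t

/-- `s6H` on the enumeration (pattern-matching table). [this work] -/
def s6HM (x y z : M3) : ℤ :=
  match x, y, z with
  | .b, .b, .t => 2
  | .b, .c1, .c2 => -1
  | .b, .c1, .c3 => -1
  | .b, .c2, .c1 => -1
  | .b, .c2, .c3 => -1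
  | .b, .c3, .c1 => -1
  | .b, .c3, .c2 => -1
  | .b, .t, .b => 2
  | .b, .t, .t => 2
  | .c1, .b, .c2 => -1
  | .c1, .b, .c3 => -1
  | .c1, .c2, .b => -1
  | .c1, .c2, .c3 => -1
  | .c1, .c2, .t => -1
  | .c1, .c3, .b => -1
  | .c1, .c3, .c2 => -1
  | .c1, .c3, .t => -1
  | .c1, .t, .c2 => -1
  | .c1, .t, .c3 => -1
  | .c2, .b, .c1 => -1
  | .c2, .b, .c3 => -1
  | .c2, .c1, .b => -1
  | .c2, .c1, .c3 => -1
  | .c2, .c1, .t => -1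
  | .c2, .c3, .b => -1
  | .c2, .c3, .c1 => -1
  | .c2, .c3, .t => -1
  | .c2, .t, .c1 => -1
  | .c2, .t, .c3 => -1
  | .c3, .b, .c1 => -1
  | .c3, .b, .c2 => -1
  | .c3, .c1, .b => -1
  | .c3, .c1, .c2 => -1
  | .c3, .c1, .t => -1
  | .c3, .c2, .b => -1
  | .c3, .c2, .c1 => -1
  | .c3, .c2, .t => -1
  | .c3, .t, .c1 => -1
  | .c3, .t, .c2 => -1
  | .t, .b, .b => 2
  | .t, .b, .t => 2
  | .t, .c1, .c2 => -1
  | .t, .c1, .c3 => -1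
  | .t, .c2, .c1 => -1
  | .t, .c2, .c3 => -1
  | .t, .c3, .c1 => -1
  | .t, .c3, .c2 => -1
  | .t, .t, .b => 2
  | _, _, _ => 0

/-- `kk` on the enumeration. [this work] -/
def kkM (x y : M3) : ℤ :=
  match x, y with
  | .b, .t => 1
  | .c1, .c2 => -1
  | .c1, .c3 => -1
  | .c2, .c1 => -1
  | .c2, .c3 => -1
  | .c3, .c1 => -1
  | .c3, .c2 => -1
  | .t, .b => 1
  | _, _ => 0

/-- Join in `M₃`. [this work] -/
def joinMM (x y : M3) : M3 :=
  match x, y with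
  | .b, y => y
  | x, .b => x
  | .c1, .c1 => .c1
  | .c2, .c2 => .c2
  | .c3, .c3 => .c3
  | _, _ => .t

/-- `θ` of a colour-presence triple (colour `i` present ↦ petal `i+1`; two or more ↦ `⊤`). [this work] -/
def thetaBM (h0 h1 h2 : Bool) : M3 :=
  match h0, h1, h2 with
  | false, false, false => .b
  | true, false, false => .c1
  | false, true, false => .c2
  | false, false, true => .c3
  | _, _, _ => .t

/-- Bridge for `s6H`. [this work] -/
theorem s6H_eq_s6HM : ∀ x y z : Fin 5, s6H x y z = s6HM (M3.ofFin x) (M3.ofFin y) (M3.ofFin z) := by decide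

/-- Bridge for `kk`. [this work] -/
theorem kk_eq_kkM : ∀ x y : Fin 5, kk x y = kkM (M3.ofFin x) (M3.ofFin y) := by decide

/-- Bridge for section labels: `ofFin (x ∨ θ S)`. [this work] -/
theorem ofFin_joinM_theta : ∀ (x : Fin 5) (S : Finset (Fin 3)),
    M3.ofFin (joinM x (theta S)) = joinMM (M3.ofFin x) (thetaBM (decide ((0 : Fin 3) ∈ S)) (decide ((1 : Fin 3) ∈ S)) (decide ((2 : Fin 3) ∈ S))) := by
  decide

/-- `x ∨ ⊥ = x` on the enumeration. [this work] -/
@[simp] theorem joinMM_b_right : ∀ x : M3, joinMM x M3.b = x := by decide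

/-- Associativity of the `Fin 5` join. [this work] -/
theorem joinM_joinM : ∀ x y z : Fin 5, joinM (joinM x y) z = joinM x (joinM y z) := by decide

/-! ## Linearity of nested sums -/

variable {α : Type*} [DecidableEq α]

/-- `nested` of a difference. [this work] -/
theorem nested_sub (W : Finset α) (f g : Finset α → Finset α → Finset α → ℤ) :
    nested W (fun X S T => f X S T - g X S T) = nested W f - nested W g := by
  unfold nested; simp only [sum_sub_distrib]

/-- `nested` of a sum. [this work] -/
theorem nested_add (W : Finset α) (f g : Finset α → Finset α → Finset α → ℤ) :
    nested W (fun X S T => f X S T + g X S T) = nested W f + nested W g := by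
  unfold nested; simp only [sum_add_distrib]

/-- `nested` of a constant multiple. [this work] -/
theorem nested_const_mul (W : Finset α) (k : ℤ) (f : Finset α → Finset α → Finset α → ℤ) :
    nested W (fun X S T => k * f X S T) = k * nested W f := by
  unfold nested; simp only [mul_sum]

/-! ## The block of a point in an ordered 3-partition -/

/-- Block index (`0,1,2`) of the point `v` in the ordered 3-partition `(X, S, rest)`. [this work] -/
def blk (v : α) (X S : Finset α) : Fin 3 := if v ∈ X then 0 else if v ∈ S then 1 else 2

/-- The three indicator bits of `blk` are the membership bits of the three blocks. [this work] -/
theorem blk_decide_eq {W' X S : Finset α} (hX : X ⊆ W') (hS : S ⊆ W' \ X) {v : α} (hv : v ∈ W') :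
    decide (blk v X S = 0) = decide (v ∈ X) ∧ decide (blk v X S = 1) = decide (v ∈ S) ∧
      decide (blk v X S = 2) = decide (v ∈ (W' \ X) \ S) := by
  have _ := hX
  unfold blk
  by_cases h1 : v ∈ X
  · have h2 : v ∉ S := fun h => (mem_sdiff.1 (hS h)).2 h1
    have h3 : v ∉ (W' \ X) \ S := fun h => (mem_sdiff.1 (mem_sdiff.1 h).1).2 h1
    simp [h1, h2, h3]
  · by_cases h2 : v ∈ S
    · have h3 : v ∉ (W' \ X) \ S := fun h => (mem_sdiff.1 h).2 h2
      simp [h1, h2, h3]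
    · have h3 : v ∈ (W' \ X) \ S := mem_sdiff.2 ⟨mem_sdiff.2 ⟨hv, h1⟩, h2⟩
      simp [h1, h2, h3]

/-! ## Two neighbours, and the two- and three-point label calculus -/

section Calculus

variable {c : α → α → Option (Fin 3)} {T : α → Finset (Fin 3)}

/-- Exactly two possible neighbours `u₁ ≠ u₂` in `X`, of colours `k₁, k₂`. [this work] -/
theorem nb_eq_ite₂ {v u₁ u₂ : α} {k₁ k₂ : Fin 3} {X : Finset α} (hne : u₁ ≠ u₂) (h₁ : c v u₁ = some k₁) (h₂ : c v u₂ = some k₂)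
    (h : ∀ y ∈ X, y ≠ u₁ → y ≠ u₂ → c v y = none) :
    nb c v X = (if u₁ ∈ X then {k₁} else ∅) ∪ (if u₂ ∈ X then {k₂} else ∅) := by
  ext i
  rw [mem_nb, mem_union]
  constructor
  · rintro ⟨y, hy, hvy⟩
    by_cases hy1 : y = u₁
    · subst hy1; rw [h₁] at hvy; rw [if_pos hy]; exact Or.inl (mem_singleton.2 (Option.some_injective _ hvy).symm)
    · by_cases hy2 : y = u₂
      · subst hy2; rw [h₂] at hvy; rw [if_pos hy]; exact Or.inr (mem_singleton.2 (Option.some_injective _ hvy).symm)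
      · rw [h y hy hy1 hy2] at hvy; exact (none_ne_some' i hvy).elim
  · rintro (hi | hi)
    · by_cases hu : u₁ ∈ X
      · rw [if_pos hu, mem_singleton] at hi; exact ⟨u₁, hu, by rw [h₁, hi]⟩
      · rw [if_neg hu] at hi; exact absurd hi (notMem_empty i)
    · by_cases hu : u₂ ∈ X
      · rw [if_pos hu, mem_singleton] at hi; exact ⟨u₂, hu, by rw [h₂, hi]⟩
      · rw [if_neg hu] at hi; exact absurd hi (notMem_empty i)

variable {F : Sunflower α} {W : Finset α}

/-- Two-point label calculus: adding two unmarked points. [this work] -/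
theorem Sunflower.IsGraphMarkOn.lab_insert₂ (h : F.IsGraphMarkOn c T W) (hsym : ∀ x y, c x y = c y x) (hirr : ∀ x, c x x = none)
    {a b : α} (ha : a ∈ W) (hb : b ∈ W) (hTa : T a = ∅) (hTb : T b = ∅) {X : Finset α} (hX : X ⊆ W) :
    F.lab (insert a (insert b X)) = joinM (F.lab X) (theta ((c a b).toFinset ∪ (nb c a X ∪ nb c b X))) := by
  rw [h.lab_insert hsym hirr ha hTa (insert_subset hb hX), nb_insert, h.lab_insert hsym hirr hb hTb hX, joinM_joinM, ← theta_union]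
  congr 2
  ext i; simp only [mem_union]; tauto

/-- Three-point label calculus: adding three unmarked points. [this work] -/
theorem Sunflower.IsGraphMarkOn.lab_insert₃ (h : F.IsGraphMarkOn c T W) (hsym : ∀ x y, c x y = c y x) (hirr : ∀ x, c x x = none)
    {a b d : α} (ha : a ∈ W) (hb : b ∈ W) (hd : d ∈ W) (hTa : T a = ∅) (hTb : T b = ∅) (hTd : T d = ∅) {X : Finset α} (hX : X ⊆ W) :
    F.lab (insert a (insert b (insert d X))) =
      joinM (F.lab X) (theta ((c a b).toFinset ∪ (c a d).toFinset ∪ (c b d).toFinset ∪ (nb c a X ∪ nb c b X ∪ nb c d X))) := by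
  rw [h.lab_insert hsym hirr ha hTa (insert_subset hb (insert_subset hd hX)), nb_insert, nb_insert,
    h.lab_insert₂ hsym hirr hb hd hTb hTd hX, joinM_joinM, ← theta_union]
  congr 2
  ext i; simp only [mem_union]; tauto

/-- **Generic spectator-weighted polarised antipodal-Gladkov row** with nested offsets `G₂ ⊆ G₁` and a nonnegative weight of the first block.
[this work] -/
theorem Sunflower.nested_weight_mul_kk_union_nonneg (F : Sunflower α) (W G₁ G₂ : Finset α) (hG : G₂ ⊆ G₁) (w : Finset α → ℤ)
    (hw : ∀ X, 0 ≤ w X) : 0 ≤ nested W (fun X S T => w X * kk (F.lab (G₁ ∪ S)) (F.lab (G₂ ∪ T))) := by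
  unfold nested
  refine sum_nonneg fun X _ => ?_
  rw [← mul_sum]
  exact mul_nonneg (hw X) (F.antipodal_gladkov_polarized (W \ X) G₁ G₂ hG)

end Calculus

end Summit.CriticalPhenomena.PercolationContinuityZ3.Theorems.SunflowerPartition
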